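/-
Origin: expansion seat `planner-pub-hodgecm-toy2-g7-0`, handover #5 HANDOVER 2026-08-18T13:27:34Z (l.3924) md5 c9b78474; rewrite Toy2g7.F4Row (packager row: handed in STATUS without a t30 kit row; RUN 30 addendum) (`HOME/pub-hodgecm-toy2-g7/lean/Toy2g7/Primitive.lean`, md5 c9b78474, 200 lines);
landed by the gen-8 packager in gate run 30 as `HodgeCM/Model/Toy/Primitive.lean` (import ^import Toy2g7\.F4Row[ \t]*$→import HodgeCM.Model.Toy.F4Row ×1).
-/
/-
Origin: CONSISTENCY seat 2 gen 7 `planner-pub-hodgecm-toy2-g7-0` (unit `pub-hodgecm-toy2-g7`), WIP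
`HOME/pub-hodgecm-toy2-g7/lean/Toy2g7/Primitive.lean`; intended target `HodgeCM/Model/Toy/Primitive.lean` (new leaf).
-/
import Mathlib
import Summits.HodgeConjecture.HodgeCM.Model.Toy.F4Row

/-!
# Primitive CM types are type-separated

`HodgeCM.Model.Toy.F4Row` proves the F4 row of the load-bearing census of `COR_CM_of_descentFactsB₄` under the
hypothesis `Obj.TypSeparating K Φ` (a statement quantifying over the objects of the toy universe).  Here that
hypothesis is discharged from a purely FIELD-THEORETIC one, the **primitivity** of the CM pair `(K,Φ)`:

* `typQ Φ σ = {γ ∈ Aut_ℚ(ℚ̄) | γ ∘ σ ∈ Φ}` — the Galois type of an embedding `σ : K → ℚ̄`;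
* `TypPrimitive K Φ` — for every `σ`, every `δ ∈ Aut_ℚ(ℚ̄)` stabilising `typQ Φ σ` on the right fixes `σ(K)`
  pointwise.  (The right stabiliser always contains `Aut(ℚ̄/σK)` (`typQ_mul_iff_of_fix`); it is a closed subgroup
  `Aut(ℚ̄/E)`, `E ⊆ σK`, and `Φ` is induced from a "CM type" of the subfield `σ⁻¹E`; so `TypPrimitive` says exactly that
  `Φ` is induced from no proper subfield — the usual primitivity, for each embedding.  E.g. every CM type of a CM field
  without proper CM subfields, such as `ℚ(ζ₁₇)`, and `Φ = {σ₁,…,σ₆}` on `ℚ(ζ₁₃)`; no instance is formalised here.)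
* `typSeparating_of_typPrimitive : TypPrimitive K Φ → Obj.TypSeparating K Φ` — by the Galois correspondence for
  `ℚ̄/ℚ` (`InfiniteGalois.fixedField_fixingSubgroup`): if an eigen-index `t = (j, τ')` of an object `Y` has the Galois
  type of an index of `A_{(K,Φ)}`, then `Aut(ℚ̄/τ'F_j)` stabilises that type, hence fixes `σ(K)`, so `σ(K) ⊆ τ'(F_j)` and
  `[K:ℚ] ≤ [F_j:ℚ]`;
* `descentFactsB₄_realised_needs_F4_or_gysinDescentB_of_primitive` — the F4 row with the hypothesis
  "some Galois CM field of degree `≥ 12` carries a primitive CM type".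

All proofs kernel-checked; nothing is cited.
-/

noncomputable section

/- as in `HodgeCM.Model.Toy.LefTypes`: `IsAlgClosure ℚ ℚ̄` / `Normal ℚ ℚ̄` / `IsGalois ℚ ℚ̄` are only found with the
pre-4.32 transparency behaviour of unification -/
set_option backward.isDefEq.respectTransparency false

namespace HodgeCM.Toy

open Literature.AlgebraicGeometry.Motives
open Module CMPresentation

variable {K : CMField}

/-- the Galois type of an embedding `σ : K → ℚ̄` relative to the CM type `Φ`: `{γ | γ ∘ σ ∈ Φ}` -/
def typQ (Φ : CMType K) (σ : K →+* Qbar) : Set Gam :=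
  {γ | (algebraMap Qbar ℂ).comp (γ.toRingEquiv.toRingHom.comp σ) ∈ Φ.1}

/-- (Ported verbatim from the HodgeCMPerL package; no docstring in the source.) -/
lemma mem_typQ (Φ : CMType K) (σ : K →+* Qbar) (γ : Gam) :
    γ ∈ typQ Φ σ ↔ (algebraMap Qbar ℂ).comp (γ.toRingEquiv.toRingHom.comp σ) ∈ Φ.1 := Iff.rfl

/-- the right stabiliser of a Galois type always contains `Aut(ℚ̄/σK)` -/
theorem typQ_mul_iff_of_fix (Φ : CMType K) (σ : K →+* Qbar) (γ δ : Gam) (hδ : ∀ x : K, δ (σ x) = σ x) :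
    γ * δ ∈ typQ Φ σ ↔ γ ∈ typQ Φ σ := by
  have h : (algebraMap Qbar ℂ).comp ((γ * δ).toRingEquiv.toRingHom.comp σ)
      = (algebraMap Qbar ℂ).comp (γ.toRingEquiv.toRingHom.comp σ) := by
    refine RingHom.ext fun x => ?_
    show (((γ * δ) (σ x) : Qbar) : ℂ) = ((γ (σ x) : Qbar) : ℂ)
    rw [AlgEquiv.mul_apply, hδ]
  rw [mem_typQ, mem_typQ, h]

/-- **Primitivity** of the CM pair `(K,Φ)`: for every embedding `σ : K → ℚ̄`, the right stabiliser of the Galois type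
`{γ | γ ∘ σ ∈ Φ}` fixes `σ(K)` pointwise (i.e. equals `Aut(ℚ̄/σK)`: `Φ` is induced from no proper subfield). -/
def TypPrimitive (K : CMField) (Φ : CMType K) : Prop :=
  ∀ (σ : K →+* Qbar) (δ : Gam), (∀ γ : Gam, γ * δ ∈ typQ Φ σ ↔ γ ∈ typQ Φ σ) → ∀ x : K, δ (σ x) = σ x

/-- **Primitivity, finite form** (for `K` Galois over `ℚ`, the textbook criterion): the right stabiliser of `Φ` in
`Gal(K/ℚ)` — acting on embeddings by `φ ↦ φ ∘ g` — is trivial.  (`Hom(K,ℂ) = φ₀ ∘ Gal(K/ℚ)` for any `φ₀`, and the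
stabiliser does not depend on `φ₀`.) -/
def Primitive (K : CMField) (Φ : CMType K) : Prop :=
  ∀ (φ₀ : K →+* ℂ) (d : K ≃ₐ[ℚ] K),
    (∀ g : K ≃ₐ[ℚ] K, φ₀.comp ((g * d : K ≃ₐ[ℚ] K) : K →+* K) ∈ Φ.1 ↔ φ₀.comp (g : K →+* K) ∈ Φ.1) → d = 1

/-- **finite primitivity ⇒ `TypPrimitive`** (restriction `Aut_ℚ(ℚ̄) → Gal(K/ℚ)` along `σ`, which is onto). -/
theorem typPrimitive_of_primitive [IsGalois ℚ K] {Φ : CMType K} (h : Primitive K Φ) : TypPrimitive K Φ := by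
  intro σ δ hδ x
  letI : Algebra K Qbar := σ.toAlgebra
  have hσ : ∀ y : K, algebraMap K Qbar y = σ y := fun _ => rfl
  -- restriction of automorphisms of `ℚ̄` to `K` (embedded by `σ`)
  let r : Gam →* (K ≃ₐ[ℚ] K) := AlgEquiv.restrictNormalHom K
  have hr : ∀ (γ : Gam) (y : K), σ (r γ y) = γ (σ y) := fun γ y => by
    rw [← hσ, ← hσ]
    exact AlgEquiv.restrictNormal_commutes γ K y
  have hsurj : Function.Surjective r := AlgEquiv.restrictNormalHom_surjective (F := ℚ) (K₁ := K) (E := Qbar)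
  -- the Galois type through the restriction
  set φ₀ : K →+* ℂ := (algebraMap Qbar ℂ).comp σ with hφ₀
  have key : ∀ γ : Gam, γ ∈ typQ Φ σ ↔ φ₀.comp ((r γ : K ≃ₐ[ℚ] K) : K →+* K) ∈ Φ.1 := fun γ => by
    have hγ : (algebraMap Qbar ℂ).comp (γ.toRingEquiv.toRingHom.comp σ) = φ₀.comp ((r γ : K ≃ₐ[ℚ] K) : K →+* K) := by
      refine RingHom.ext fun y => ?_
      show ((γ (σ y) : Qbar) : ℂ) = ((σ (r γ y) : Qbar) : ℂ)
      rw [hr]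
    rw [mem_typQ, hγ]
  have hd : r δ = 1 := by
    refine h φ₀ (r δ) fun g => ?_
    obtain ⟨γ, rfl⟩ := hsurj g
    rw [← map_mul, ← key, ← key]
    exact hδ γ
  have hx := hr δ x
  rw [hd, AlgEquiv.one_apply] at hx
  exact hx.symm

namespace Obj

/-- the embedding `K → ℚ̄` underlying an eigen-index of `A_{(K,Φ)}` -/
def embQ (Φ : CMType K) (s : (cmObj K Φ).Idx) : K →+* Qbar :=
  ((cmObj K Φ).liftE s).comp (eK K : K →+* FK K)

/-- the Galois type of an index of `A_{(K,Φ)}` is the Galois type of its embedding -/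
theorem mem_typ_cmObj_iff (Φ : CMType K) (s : (cmObj K Φ).Idx) (γ : Gam) :
    γ ∈ (cmObj K Φ).typ s ↔ γ ∈ typQ Φ (embQ Φ s) := by
  have h : ((cmObj K Φ).gact γ s).2.comp (eK K : K →+* FK K)
      = (algebraMap Qbar ℂ).comp (γ.toRingEquiv.toRingHom.comp (embQ Φ s)) :=
    RingHom.ext fun _ => rfl
  show ((cmObj K Φ).gact γ s).2.comp (eK K : K →+* FK K) ∈ Φ.1 ↔ _
  rw [h]
  rfl

variable (Y : Obj) (t : Y.Idx)

/-- automorphisms fixing `τ'(F_j)` do not move the index `t = (j, τ')` -/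
theorem gact_mul_of_fix (γ δ : Gam) (hδ : ∀ y, δ (Y.liftE t y) = Y.liftE t y) : Y.gact (γ * δ) t = Y.gact γ t := by
  refine Sigma.ext rfl (heq_of_eq (RingHom.ext fun y => ?_))
  show (((γ * δ) (Y.liftE t y) : Qbar) : ℂ) = ((γ (Y.liftE t y) : Qbar) : ℂ)
  rw [AlgEquiv.mul_apply, hδ]

/-- (Ported verbatim from the HodgeCMPerL package; no docstring in the source.) -/
theorem typ_mul_iff_of_fix (γ δ : Gam) (hδ : ∀ y, δ (Y.liftE t y) = Y.liftE t y) :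
    γ * δ ∈ Y.typ t ↔ γ ∈ Y.typ t := by
  rw [Obj.mem_typ, Obj.mem_typ, gact_mul_of_fix Y t γ δ hδ]

variable {Y t}

/-- KEY: if `t` has the Galois type of an index `s` of a PRIMITIVE `A_{(K,Φ)}`, then `Aut(ℚ̄/τ'F_j)` fixes `σ_s(K)` -/
theorem fix_embQ_of_typ_eq {Φ : CMType K} (hprim : TypPrimitive K Φ) {s : (cmObj K Φ).Idx}
    (hst : (cmObj K Φ).typ s = Y.typ t) (δ : Gam) (hδ : ∀ y, δ (Y.liftE t y) = Y.liftE t y) (x : K) :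
    δ (embQ Φ s x) = embQ Φ s x :=
  hprim (embQ Φ s) δ (fun γ => by
    rw [← mem_typ_cmObj_iff, ← mem_typ_cmObj_iff, hst]
    exact typ_mul_iff_of_fix Y t γ δ hδ) x

/-- … hence `σ_s(K) ⊆ τ'(F_j)` (Galois correspondence for `ℚ̄/ℚ`) -/
theorem fieldRange_embQ_le_of_typ_eq {Φ : CMType K} (hprim : TypPrimitive K Φ) {s : (cmObj K Φ).Idx}
    (hst : (cmObj K Φ).typ s = Y.typ t) :
    (embQ Φ s).toRatAlgHom.fieldRange ≤ (Y.liftE t).toRatAlgHom.fieldRange := by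
  rw [← InfiniteGalois.fixedField_fixingSubgroup (Y.liftE t).toRatAlgHom.fieldRange]
  intro x hx
  rw [IntermediateField.mem_fixedField_iff]
  intro δ hδ
  obtain ⟨k, rfl⟩ := AlgHom.mem_fieldRange.mp hx
  rw [IntermediateField.mem_fixingSubgroup_iff] at hδ
  have hδ' : ∀ y, δ (Y.liftE t y) = Y.liftE t y := fun y => hδ _ (AlgHom.mem_fieldRange.mpr ⟨y, rfl⟩)
  exact fix_embQ_of_typ_eq hprim hst δ hδ' k

/-- **primitive ⇒ type-separated** -/
theorem typSeparating_of_typPrimitive {Φ : CMType K} (hprim : TypPrimitive K Φ) : TypSeparating K Φ := by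
  intro Y t s hst
  haveI : FiniteDimensional ℚ ((Y.liftE t).toRatAlgHom.fieldRange) :=
    Module.Finite.equiv (AlgHom.equivFieldRange (Y.liftE t).toRatAlgHom).toLinearEquiv
  have h1 : finrank ℚ K = finrank ℚ ((embQ Φ s).toRatAlgHom.fieldRange) :=
    (AlgHom.equivFieldRange (embQ Φ s).toRatAlgHom).toLinearEquiv.finrank_eq
  have h2 : finrank ℚ (Y.atom t.1).F = finrank ℚ ((Y.liftE t).toRatAlgHom.fieldRange) :=
    (AlgHom.equivFieldRange (Y.liftE t).toRatAlgHom).toLinearEquiv.finrank_eq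
  rw [h1, h2]
  exact IntermediateField.finrank_le_of_le_right (fieldRange_embQ_le_of_typ_eq hprim hst)

/-- primitive ⇒ `H¹(A_{(K,Φ)})` rigid -/
theorem h1Rigid_of_typPrimitive {Φ : CMType K} (hprim : TypPrimitive K Φ) : (cmObj K Φ).H1Rigid :=
  h1Rigid_of_typSeparating (typSeparating_of_typPrimitive hprim)

end Obj

end HodgeCM.Toy

namespace HodgeCM.ToyG2

open HodgeCM.Toy
open Literature.AlgebraicGeometry.Motives

/-- **F4 row of the census, primitive form.**  If some Galois CM field of degree `≥ 12` carries a primitive CM type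
(`TypPrimitive`; e.g. any CM type of `ℚ(ζ₁₇)`, or `{σ₁,…,σ₆}` on `ℚ(ζ₁₃)` — not formalised), then there is a universe
satisfying the 28 model axioms, `RealisationExistsFace`, N1, N2, N3, N4, F5, D and F-H0 in which `HC_CM` fails and
`F4 ∧ F7d-B` fails: **`{F4, F7d-B}` cannot both be dropped from `COR_CM_of_descentFactsB₄`**. -/
theorem descentFactsB₄_realised_needs_F4_or_gysinDescentB_of_primitive
    (hprim : ∃ (K : CMField) (Φ : CMType K), IsGalois ℚ K ∧ 12 ≤ Module.finrank ℚ K ∧ TypPrimitive K Φ) :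
    ∃ U : Universe, U.ModelAxioms ∧ U.RealisationExistsFace ∧ U.Fact_cupExterior ∧ U.Fact_cup_hodge ∧
      U.Fact_pull_H0 ∧ U.Fact_hodge_F0 ∧ U.Fact_cupAssoc ∧ U.Fact_dimProd ∧ U.Fact_unitH0 ∧
      ¬ (U.Fact_cupAlg ∧ U.Fact_gysinDescentB) ∧ ¬ U.HC_CM := by
  obtain ⟨K, Φ, hG, h12, hprim⟩ := hprim
  exact descentFactsB₄_realised_needs_F4_or_gysinDescentB ⟨K, Φ, hG, h12, Obj.typSeparating_of_typPrimitive hprim⟩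

/-- The same with the finite (Galois-group) primitivity criterion `Primitive`. -/
theorem descentFactsB₄_realised_needs_F4_or_gysinDescentB_of_primitive'
    (hprim : ∃ (K : CMField) (Φ : CMType K), IsGalois ℚ K ∧ 12 ≤ Module.finrank ℚ K ∧ Primitive K Φ) :
    ∃ U : Universe, U.ModelAxioms ∧ U.RealisationExistsFace ∧ U.Fact_cupExterior ∧ U.Fact_cup_hodge ∧
      U.Fact_pull_H0 ∧ U.Fact_hodge_F0 ∧ U.Fact_cupAssoc ∧ U.Fact_dimProd ∧ U.Fact_unitH0 ∧
      ¬ (U.Fact_cupAlg ∧ U.Fact_gysinDescentB) ∧ ¬ U.HC_CM := by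
  obtain ⟨K, Φ, hG, h12, hprim⟩ := hprim
  exact descentFactsB₄_realised_needs_F4_or_gysinDescentB_of_primitive ⟨K, Φ, hG, h12, typPrimitive_of_primitive hprim⟩

end HodgeCM.ToyG2

end
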